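/-
Copyright: lit-balaban cell (HOME `run/shared/lean/pub/lit-balaban/`), Phase-2 proof seat p12 (gen 7).  The proofs reproduce the
printed arguments; nothing is claimed beyond what the kernel checks below.
-/
import Literature.MathematicalPhysics.QuantumFieldTheory.DybalskiStottmeisterTanimoto2024.DST24GreenFunction

/-!
# `DybalskiStottmeisterTanimoto2024.DST24CriticalPointEquation` — [DybalskiStottmeisterTanimoto2024] **§3.3 Theorem
# (critical-point-equation)** PROVED: at a constrained critical point `A⃗ = ΓR*Q*[QΓR*Q*]⁻¹QΓ∂*r⃗ − Γ∂*r⃗` (3.13), and conversely,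
# given (as in the print) the invertibility of `QΓR*Q*` (Lemma (Q-G-R-Q-lemma), §4.4); with the intermediate steps
# (intermediate-equation) `A⃗ = −ΓR*C⃗ − Γ∂*r⃗` and (Q-on-both-sides) `QΓR*Q*(QC⃗) = −QΓ∂*r⃗`

statement-level skeleton of published theorems with citation tags; proofs where landed; nothing here is a claim about
the Yang–Mills mass gap

W. Dybalski, A. Stottmeister, Y. Tanimoto, *The Bałaban variational problem in the non-linear sigma model*, Rev. Math. Phys.
**36** (2024), arXiv:2403.09800; source held `paper:arxiv-2403.09800` (§3.3 = tex chunks p0009–p0010).  Unit `lit-balaban-p12`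
(gen 7).  Inputs: `second_equation_critical`, `Q_Avec_eq_zero` (`DST24CriticalPoint`), `Gamma` (`DST24GreenFunction`).

WHAT IS PRINTED (§3.3, proof of Theorem (critical-point-equation)) AND PROVED HERE.
* «`R*_{A⃗}`» acting on vector fields, and the map «`QΓR*Q*` … on `𝓛²(Ω₁; ℝ³)`» — `RstarOp`, `Dop`.
* (intermediate-equation) «As we checked in Section (simplification), the constraint has the form `Q(A⃗) = 0`.  Thus we can replace
  `Δ_Ω` with `Δ_Ω − Q*Q` in (second-equation-critical), which gives, in terms of the Green function (Green), `A⃗ = −ΓR*C⃗ − Γ∂*r⃗`»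
  — `intermediate_equation` (critical ⇔ ∃ block-constant `C⃗` with this identity).
* «Now by applying `Q` to both sides, we obtain `QΓR*C⃗ + QΓ∂*r⃗ = 0`» — `Q_intermediate`.
* **Theorem (critical-point-equation)** «At a critical point of the action (action-one-x) in `𝔘_ε(Ω)`, with the constraint
  (constraint), the following equation holds `A⃗ = R… = ΓR*_{A⃗}Q*[QΓR*_{A⃗}Q*]⁻¹QΓ∂*r⃗_{A⃗} − Γ∂*r⃗_{A⃗}`.  Conversely, any solution of
  this equation is a critical point.» («we also use that `QΓR*Q*` is an invertible map on `𝓛²(Ω₁;ℝ³)`, which is shown in Lemma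
  (Q-G-R-Q-lemma)» — here an explicit hypothesis `D`/`hD`) — `critical_point_equation`.
-/

namespace Literature.MathematicalPhysics.QuantumFieldTheory.DybalskiStottmeisterTanimoto2024.DST24CriticalPointEquation

open scoped Quaternion RealInnerProductSpace BigOperators
open Literature.MathematicalPhysics.QuantumFieldTheory.Federbush1986
open Literature.MathematicalPhysics.QuantumFieldTheory.DybalskiStottmeisterTanimoto2024.DST24Setting
open Literature.MathematicalPhysics.QuantumFieldTheory.DybalskiStottmeisterTanimoto2024.DST24Configurations
open Literature.MathematicalPhysics.QuantumFieldTheory.DybalskiStottmeisterTanimoto2024.DST24LinearConstraint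
open Literature.MathematicalPhysics.QuantumFieldTheory.DybalskiStottmeisterTanimoto2024.DST24TangentSpace
open Literature.MathematicalPhysics.QuantumFieldTheory.DybalskiStottmeisterTanimoto2024.DST24CriticalPoint
open Literature.MathematicalPhysics.QuantumFieldTheory.DybalskiStottmeisterTanimoto2024.DST24GreenFunction

noncomputable section

variable {L n₁ : ℕ}

/-- `R*_{A⃗}` as an operator on vector fields: `(R*f)(x) := R_{A⃗(x)}^* f(x)`. [cite: DybalskiStottmeisterTanimoto2024, §3.3 (3.14′), Theorem (critical-point-equation)] -/
def RstarOp (A : Site L n₁ → su2) (f : Site L n₁ → su2) : Site L n₁ → su2 := fun x => Rstar (A x) (f x)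

/-- `(R*f)(x) = R(x)*f(x)`. [cite: DybalskiStottmeisterTanimoto2024, §3.3 (3.14′)] -/
theorem RstarOp_apply (A f : Site L n₁ → su2) (x : Site L n₁) : RstarOp A f x = Rstar (A x) (f x) := rfl

/-- `R*(f + f′) = R*f + R*f′`. [cite: DybalskiStottmeisterTanimoto2024, §3.3 (3.14′)] -/
theorem RstarOp_add (A f f' : Site L n₁ → su2) : RstarOp A (f + f') = RstarOp A f + RstarOp A f' := by
  funext x; simp only [RstarOp, Pi.add_apply, map_add]

/-- `R*(cf) = cR*f`. [cite: DybalskiStottmeisterTanimoto2024, §3.3 (3.14′)] -/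
theorem RstarOp_smul (A : Site L n₁ → su2) (c : ℝ) (f : Site L n₁ → su2) : RstarOp A (c • f) = c • RstarOp A f := by
  funext x; simp only [RstarOp, Pi.smul_apply, map_smul]

/-- `R*(−f) = −R*f`. [cite: DybalskiStottmeisterTanimoto2024, §3.3 (3.14′)] -/
theorem RstarOp_neg (A f : Site L n₁ → su2) : RstarOp A (-f) = -RstarOp A f := by
  funext x; simp only [RstarOp, Pi.neg_apply, map_neg]

/-- `Q*(−c) = −Q*c`. [cite: DybalskiStottmeisterTanimoto2024, §2.1 (2.6)] -/
theorem Qstar_neg {M : Type*} [AddCommGroup M] (c : CSite n₁ → M) : Qstar L (-c) = -Qstar L c := rfl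

/-- `Q(−f) = −Qf`. [cite: DybalskiStottmeisterTanimoto2024, §2.1 (2.5)] -/
theorem Q_neg {M : Type*} [AddCommGroup M] [Module ℝ M] (f : Site L n₁ → M) : Q L (-f) = -Q L f := by
  funext y; simp only [Q_apply, Pi.neg_apply, Finset.sum_neg_distrib, smul_neg]

/-- «`QΓR*Q*` … a map on `𝓛²(Ω₁; ℝ³)`»: `D_{A⃗} := QΓR*_{A⃗}Q*`. [cite: DybalskiStottmeisterTanimoto2024, §3.3 Theorem (critical-point-equation); §4.4 Lemma (Q-G-R-Q-lemma) («`D_{A⃗} := QΓR*_{A⃗}Q*`»)] -/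
def Dop (hL : 0 < L) (A : Site L n₁ → su2) : (CSite n₁ → su2) →ₗ[ℝ] (CSite n₁ → su2) where
  toFun c := Q L (Gamma hL (RstarOp A (Qstar L c)))
  map_add' c c' := by rw [Qstar_add, RstarOp_add, map_add, Q_add]
  map_smul' r c := by rw [Qstar_smul, RstarOp_smul, map_smul, Q_smul, RingHom.id_apply]

/-- `D_{A⃗} c = QΓR*Q*c`. [cite: DybalskiStottmeisterTanimoto2024, §3.3 Theorem (critical-point-equation)] -/
@[simp] theorem Dop_apply (hL : 0 < L) (A : Site L n₁ → su2) (c : CSite n₁ → su2) :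
    Dop hL A c = Q L (Gamma hL (RstarOp A (Qstar L c))) := rfl

/-- `(−Δ_Ω + Q*Q)` applied to `A⃗` with `QA⃗ = 0` is `−Δ_Ω A⃗` («we can replace `Δ_Ω` with `Δ_Ω − Q*Q`»).
[cite: DybalskiStottmeisterTanimoto2024, §3.3 proof of Theorem (critical-point-equation)] -/
theorem Mfun_eq_neg_laplace_of_Q_eq_zero {f : Site L n₁ → su2} (hQ : Q L f = 0) : Mfun L f = -laplace f := by
  rw [Mfun_apply, hQ]
  funext x
  simp only [Pi.add_apply, Pi.neg_apply, Qstar_apply, Pi.zero_apply, add_zero]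

/-- **(intermediate-equation).** For a constrained small-field `U = U′V` (regime `4c_{1/2}Lε ≤ 1`): `U` is a constrained critical
point iff «`A⃗ = −ΓR*C⃗ − Γ∂*r⃗`» for some block-constant `C⃗ = Q*c`. [cite: DybalskiStottmeisterTanimoto2024, §3.3 (intermediate-equation)] -/
theorem intermediate_equation (hL : 0 < L) {ε : ℝ} (hε : 0 < ε) (h1 : 4 * ch * L * ε ≤ 1) {U : Conf L n₁}
    (hU : U ∈ smallField ε) {V : CConf n₁} (hC : avg U = V) :
    IsConstrainedCritical V U ↔ ∃ c : CSite n₁ → su2,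
      Avec (Uprime U V) = -(Gamma hL (RstarOp (Avec (Uprime U V)) (Qstar L c)))
        - Gamma hL (delStar (rvec (Uprime U V) V)) := by
  have hQ := Q_Avec_eq_zero hL hε h1 hU hC
  have hM := Mfun_eq_neg_laplace_of_Q_eq_zero hQ
  rw [second_equation_critical hL hε h1 hU hC]
  refine exists_congr fun c => ?_
  constructor
  · intro h
    -- `(−Δ_Ω + Q*Q)A⃗ = −Δ_Ω A⃗ = −(R*Q*c + ∂*r⃗)`, then apply `Γ`
    have hMA : Mfun L (Avec (Uprime U V)) =
        -(RstarOp (Avec (Uprime U V)) (Qstar L c)) - delStar (rvec (Uprime U V) V) := by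
      rw [hM]
      funext x
      have hx := h x
      simp only [Pi.neg_apply, Pi.sub_apply, RstarOp_apply, Qstar_apply]
      rw [← hx]
      abel
    have := congrArg (Gamma hL) hMA
    rw [Gamma_Mfun, map_sub, map_neg] at this
    exact this
  · intro h x
    -- apply `(−Δ_Ω + Q*Q)` to the identity and use `QA⃗ = 0`
    have hMA : Mfun L (Avec (Uprime U V)) =
        -(RstarOp (Avec (Uprime U V)) (Qstar L c)) - delStar (rvec (Uprime U V) V) := by
      have e := congrArg (Mfun L) h
      rw [e]
      have lin : ∀ f g : Site L n₁ → su2, Mfun L (-f - g) = -Mfun L f - Mfun L g := fun f g => by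
        have := (Mop (E := su2) L).map_sub (-f) g
        rw [(Mop (E := su2) L).map_neg] at this
        simpa only [Mop_apply] using this
      rw [lin, Mfun_Gamma, Mfun_Gamma]
    rw [hM] at hMA
    have hx := congrFun hMA x
    simp only [Pi.neg_apply, Pi.sub_apply, RstarOp_apply, Qstar_apply] at hx
    rw [laplace_apply] at hx ⊢
    -- `hx : -(-∂*∂A)(x) = -(R* c) - ∂*r(x)`
    have : -delStar (del (Avec (Uprime U V))) x =
        Rstar (Avec (Uprime U V) x) (c (blk x)) + delStar (rvec (Uprime U V) V) x := by
      rw [neg_eq_iff_eq_neg]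
      rw [neg_neg] at hx
      rw [hx]
      abel
    rw [this]
    abel

/-- «Now by applying `Q` to both sides, we obtain `QΓR*C⃗ + QΓ∂*r⃗ = 0`» (with `QA⃗ = 0`): for the `c` of (intermediate-equation),
`QΓR*Q*c = −QΓ∂*r⃗`, i.e. `D_{A⃗} c = −QΓ∂*r⃗`. [cite: DybalskiStottmeisterTanimoto2024, §3.3 proof of Theorem (critical-point-equation)] -/
theorem Q_intermediate (hL : 0 < L) {A : Site L n₁ → su2} (hQ : Q L A = 0) {c : CSite n₁ → su2} {g : Site L n₁ → su2}
    (h : A = -(Gamma hL (RstarOp A (Qstar L c))) - Gamma hL g) :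
    Dop hL A c = -Q L (Gamma hL g) := by
  have e := congrArg (Q L) h
  rw [hQ] at e
  rw [Dop_apply, eq_neg_iff_add_eq_zero]
  have lin : Q L (-(Gamma hL (RstarOp A (Qstar L c))) - Gamma hL g) =
      -Q L (Gamma hL (RstarOp A (Qstar L c))) - Q L (Gamma hL g) := by
    rw [sub_eq_add_neg, Q_add, Q_neg, Q_neg, ← sub_eq_add_neg]
  rw [lin] at e
  have e' := e.symm
  rwa [← neg_add', neg_eq_zero] at e'

/-- **Theorem (critical-point-equation).** «At a critical point of the action (action-one-x) in `𝔘_ε(Ω)`, with the constraint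
(constraint), the following equation holds: `A⃗ = ΓR*_{A⃗}Q*[QΓR*_{A⃗}Q*]⁻¹QΓ∂*r⃗_{A⃗} − Γ∂*r⃗_{A⃗}` (3.13).  Conversely, any solution
of this equation is a critical point.»  As in the print the invertibility of `QΓR*_{A⃗}Q*` is used («shown in Lemma
(Q-G-R-Q-lemma)», §4.4, small `ε`): here it is the hypothesis `D`, `hD` (`D` a linear automorphism of `𝓛²(Ω₁;ℝ³)` acting as
`QΓR*_{A⃗}Q*`, `D.symm = [QΓR*Q*]⁻¹`).  Regime `4c_{1/2}Lε ≤ 1`, `U = U′V` constrained small-field, `A⃗ = A⃗(U′)`.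
[cite: DybalskiStottmeisterTanimoto2024, §3.3 Theorem (critical-point-equation), (3.13)] -/
theorem critical_point_equation (hL : 0 < L) {ε : ℝ} (hε : 0 < ε) (h1 : 4 * ch * L * ε ≤ 1) {U : Conf L n₁}
    (hU : U ∈ smallField ε) {V : CConf n₁} (hC : avg U = V)
    (D : (CSite n₁ → su2) ≃ₗ[ℝ] (CSite n₁ → su2)) (hD : ∀ c, D c = Dop hL (Avec (Uprime U V)) c) :
    IsConstrainedCritical V U ↔
      Avec (Uprime U V) =
        Gamma hL (RstarOp (Avec (Uprime U V))
          (Qstar L (D.symm (Q L (Gamma hL (delStar (rvec (Uprime U V) V)))))))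
        - Gamma hL (delStar (rvec (Uprime U V) V)) := by
  have hQ := Q_Avec_eq_zero hL hε h1 hU hC
  rw [intermediate_equation hL hε h1 hU hC]
  constructor
  · rintro ⟨c, hc⟩
    -- `D c = −QΓ∂*r⃗`, so `c = −D⁻¹QΓ∂*r⃗`
    have hDc : D c = -Q L (Gamma hL (delStar (rvec (Uprime U V) V))) := by
      rw [hD]; exact Q_intermediate hL hQ hc
    have hc' : c = -D.symm (Q L (Gamma hL (delStar (rvec (Uprime U V) V)))) := by
      rw [← map_neg, ← hDc, LinearEquiv.symm_apply_apply]
    rw [hc', Qstar_neg, RstarOp_neg, map_neg, neg_neg] at hc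
    exact hc
  · intro h
    refine ⟨-D.symm (Q L (Gamma hL (delStar (rvec (Uprime U V) V)))), ?_⟩
    rw [Qstar_neg, RstarOp_neg, map_neg, neg_neg]
    exact h

end

end Literature.MathematicalPhysics.QuantumFieldTheory.DybalskiStottmeisterTanimoto2024.DST24CriticalPointEquation
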